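import Literature.NumberTheory.EllipticCurves.Rank1Residual.GVParityIsogenyConjugationProofs
import Literature.NumberTheory.EllipticCurves.Rank1Residual.GVParityOrdinaryLineProofs
import Literature.NumberTheory.EllipticCurves.Rank1Residual.GVParityLineTypeProofs
import Literature.NumberTheory.EllipticCurves.Rank1Residual.GVParityTransferProofs
import Literature.NumberTheory.EllipticCurves.Rank1Residual.GVParityTwistProofs
import Literature.NumberTheory.EllipticCurves.ZpExtensionProofs
import Literature.NumberTheory.GaloisRepresentations.ArtinFormalismInductionProofs
import Literature.NumberTheory.EllipticCurves.HeegnerPoints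
import Literature.NumberTheory.EllipticCurves.SupersingularIrreducibleProofs
import Summits.BirchSwinnertonDyer.Rank1Residual.GaloisImage.SmallImageAbelianInertia
import Literature.NumberTheory.EllipticCurves.HeegnerPointsKolyvaginCebotarevProofs
import HarnessLib

/-!
# Rigidity of the residual line: over an imaginary quadratic `K`, every `Γ_K`-stable `p`-line of
# `E[p]` (`E/ℚ`, good anomalous Eisenstein `p > 2`, no unramified rational `p`-line) is THE rational line
# (helper file for crux 2 `GoodLatticeBDPValue`, stmt-BirchSwinnertonDyer-19032, line `halves`;
# seat `bsd-line-x1-p1-w2` gen 2 — the K-to-ℚ bridge for the residual-pair binders, part 1 of 2)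

WHY. The line's stubs (`stub_anDS`, `stub_imprim`) and idea-11's AN split are typed with a K-LEVEL
residual pair `IsResidualPairOver (W.baseChange K) p θsub θquot`, while the Hecke-side facts (finite
order, `c`-invariance, unramified at `p`) are in the tree only for characters RESTRICTED FROM `ℚ`
(`IsHeckeCharOf.galConj_eq_of_restrictField`, [LOCp]). This file supplies the group theory that
identifies the two:

* §1 lines in `E[p](ℚ̄)`: an element of `Γ_ℚ` stabilising a `p`-line acts on it by an integer scalar
  (`exists_int_smul_eq_of_stable`); an element stabilising THREE distinct `p`-lines acts on all of `E[p]`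
  by one scalar (`exists_int_smul_eq_of_three_lines`); under `Anom` + "no unramified rational line" the
  rational `p`-line is UNIQUE (both would be Serre's ordinary line, `eq_of_not_lineUnramifiedAt`).
* §2 `isRationalLine_of_forall_restrict_smul_mem`: for `K` imaginary quadratic, a `p`-line `Ψ` stable
  under `Γ_K` (acting through `absGaloisRestrict ℚ K`) is rational. Proof: `c•Ψ` (`c` complex
  conjugation, `c ∉ Γ_K`, `[Γ_ℚ : Γ_K] = 2`) is again `Γ_K`-stable; if `c•Ψ = Ψ` then `Ψ` is
  `Γ_ℚ = Γ_K ∪ cΓ_K`-stable; otherwise `Φ₀, Ψ, c•Ψ` are three `Γ_K`-stable lines, so `Γ_K` acts by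
  scalars, the `±1`-eigenvectors of `c` (`exists_fixed_and_antifixed_of_isComplexConjugation`) span
  rational lines, both equal to `Φ₀` by uniqueness, and `2Q = 0` — absurd for `p` odd.
(Part 2, `…ResidualPairFromRat`: uniqueness of Teichmüller lifts and the identification of every
K-level residual pair with the restricted ℚ-pair.)

Pure Galois-module bookkeeping on constructed objects; no definition, no named fact, no `sorry`;
nothing about BSD. References: Serre 1972 §1.11; Greenberg–Vatsal 2000 p. 4; Keller–Yin 2024 §1.4.
-/

-- the summit namespace `Summit.BirchSwinnertonDyer.BirchSwinnertonDyer` repeats the problem name by design (D-0017)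
set_option linter.dupNamespace false
set_option autoImplicit false

noncomputable section

open scoped Classical

open WeierstrassCurve NumberField IsDedekindDomain Field
  Literature.NumberTheory.EllipticCurves Literature.NumberTheory.EllipticCurves.Rank1Residual
  Literature.NumberTheory.GaloisRepresentations Summit.BirchSwinnertonDyer.Rank1Residual

namespace Summit.BirchSwinnertonDyer.BirchSwinnertonDyer.Theorems.ResidualLineRigidity

/-! ## §1 Lines in `E[p](ℚ̄)` -/

section Lines

variable {W : WeierstrassCurve ℚ} {p : ℕ} [Fact p.Prime]

/-- A non-zero point of `E[p]` has additive order `p`. [folklore] -/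
theorem addOrderOf_eq_of_ne_zero {P : geomTorsion W (p : ℤ)} (hP : P ≠ 0) : addOrderOf P = p := by
  have hp : p.Prime := Fact.out
  have hdvd : addOrderOf P ∣ p := by
    apply addOrderOf_dvd_of_nsmul_eq_zero
    have h0 := GaloisImage.natCast_zsmul_eq_zero P
    rwa [natCast_zsmul] at h0
  rcases (Nat.dvd_prime hp).mp hdvd with h1 | h2
  · exact absurd (AddMonoid.addOrderOf_eq_one_iff.mp h1) hP
  · exact h2

omit [Fact p.Prime] in
/-- If `p ∣ a` then `a • P = 0` on `E[p]`. [folklore] -/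
theorem zsmul_eq_zero_of_dvd {a : ℤ} (h : (p : ℤ) ∣ a) (P : geomTorsion W (p : ℤ)) : a • P = 0 := by
  obtain ⟨t, rfl⟩ := h
  rw [mul_comm, mul_smul, GaloisImage.natCast_zsmul_eq_zero, smul_zero]

/-- `a • P = 0` with `P ≠ 0` in `E[p]` forces `p ∣ a`. [folklore] -/
theorem dvd_of_zsmul_eq_zero {a : ℤ} {P : geomTorsion W (p : ℤ)} (hP : P ≠ 0) (h : a • P = 0) :
    (p : ℤ) ∣ a := by
  have h' := (addOrderOf_dvd_iff_zsmul_eq_zero).mpr h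
  rwa [addOrderOf_eq_of_ne_zero hP] at h'

/-- The cyclic subgroup generated by a non-zero point of `E[p]` has order `p`. [folklore] -/
theorem natCard_zmultiples_eq {P : geomTorsion W (p : ℤ)} (hP : P ≠ 0) :
    Nat.card (AddSubgroup.zmultiples P) = p := by
  rw [Nat.card_zmultiples, addOrderOf_eq_of_ne_zero hP]

/-- A `p`-line has a non-zero point. [folklore] -/
theorem exists_ne_zero_mem {Φ : AddSubgroup (geomTorsion W (p : ℤ))} (hΦ : Nat.card Φ = p) :
    ∃ P ∈ Φ, P ≠ 0 := by
  have hp : p.Prime := Fact.out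
  by_contra h
  push Not at h
  haveI : Subsingleton Φ := ⟨fun a b ↦ Subtype.ext (by rw [h a.1 a.2, h b.1 b.2])⟩
  have h1 : Nat.card Φ = 1 := Nat.card_of_subsingleton (0 : Φ)
  rw [hΦ] at h1
  exact hp.one_lt.ne' h1

/-- **An element of `Γ_ℚ` stabilising a `p`-line acts on it by an integer scalar.** [folklore] -/
theorem exists_int_smul_eq_of_stable {Φ : AddSubgroup (geomTorsion W (p : ℤ))} (hΦ : Nat.card Φ = p)
    {σ : absoluteGaloisGroup ℚ} (hσ : ∀ P ∈ Φ, σ • P ∈ Φ) :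
    ∃ a : ℤ, ∀ P ∈ Φ, σ • P = a • P := by
  obtain ⟨g, hg, hg0⟩ := exists_ne_zero_mem hΦ
  have hΦg := eq_zmultiples_of_card_eq_prime hΦ hg hg0
  have hσg : σ • g ∈ AddSubgroup.zmultiples g := hΦg ▸ hσ g hg
  obtain ⟨a, ha⟩ := AddSubgroup.mem_zmultiples_iff.mp hσg
  refine ⟨a, fun P hP ↦ ?_⟩
  obtain ⟨m, rfl⟩ := AddSubgroup.mem_zmultiples_iff.mp (hΦg ▸ hP)
  rw [smul_comm σ m g, ← ha, smul_comm m a g]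

/-- **An element of `Γ_ℚ` stabilising three pairwise distinct `p`-lines of `E[p]` acts on `E[p]` by ONE
integer scalar** (`E/ℚ` elliptic: `#E[p] = p²`, two distinct lines span and meet trivially).
[folklore] -/
theorem exists_int_smul_eq_of_three_lines [W.IsElliptic] {L₁ L₂ L₃ : AddSubgroup (geomTorsion W (p : ℤ))}
    (h₁ : Nat.card L₁ = p) (h₂ : Nat.card L₂ = p) (h₃ : Nat.card L₃ = p) (h₁₂ : L₁ ≠ L₂)
    (h₁₃ : L₁ ≠ L₃) (h₂₃ : L₂ ≠ L₃) {σ : absoluteGaloisGroup ℚ} (hσ₁ : ∀ P ∈ L₁, σ • P ∈ L₁)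
    (hσ₂ : ∀ P ∈ L₂, σ • P ∈ L₂) (hσ₃ : ∀ P ∈ L₃, σ • P ∈ L₃) :
    ∃ a : ℤ, ∀ P : geomTorsion W (p : ℤ), σ • P = a • P := by
  have hE := Rank1Residual.natCard_geomTorsion W p
  obtain ⟨a₁, ha₁⟩ := exists_int_smul_eq_of_stable h₁ hσ₁
  obtain ⟨a₂, ha₂⟩ := exists_int_smul_eq_of_stable h₂ hσ₂
  obtain ⟨a₃, ha₃⟩ := exists_int_smul_eq_of_stable h₃ hσ₃
  have htop : L₁ ⊔ L₂ = ⊤ := sup_eq_top_of_ne hE h₁ h₂ h₁₂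
  have h12 : L₁ ⊓ L₂ = ⊥ := (line_eq_or_inf_eq_bot h₁ h₂).resolve_left h₁₂
  have h13 : L₁ ⊓ L₃ = ⊥ := (line_eq_or_inf_eq_bot h₁ h₃).resolve_left h₁₃
  have h23 : L₂ ⊓ L₃ = ⊥ := (line_eq_or_inf_eq_bot h₂ h₃).resolve_left h₂₃
  -- a non-zero point of `L₃`, decomposed along `L₁ ⊕ L₂`
  obtain ⟨x, hx, hx0⟩ := exists_ne_zero_mem h₃
  obtain ⟨l₁, hl₁, l₂, hl₂, hx12⟩ := AddSubgroup.mem_sup.mp (htop ▸ AddSubgroup.mem_top x)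
  have hl₁0 : l₁ ≠ 0 := by
    rintro rfl
    rw [zero_add] at hx12
    subst hx12
    have : l₂ ∈ L₂ ⊓ L₃ := AddSubgroup.mem_inf.mpr ⟨hl₂, hx⟩
    rw [h23, AddSubgroup.mem_bot] at this
    exact hx0 this
  have hl₂0 : l₂ ≠ 0 := by
    rintro rfl
    rw [add_zero] at hx12
    subst hx12
    have : l₁ ∈ L₁ ⊓ L₃ := AddSubgroup.mem_inf.mpr ⟨hl₁, hx⟩
    rw [h13, AddSubgroup.mem_bot] at this
    exact hx0 this
  -- `σ x = a₃ x = a₁ l₁ + a₂ l₂`, so `(a₁ - a₃) l₁ = (a₃ - a₂) l₂ ∈ L₁ ⊓ L₂ = 0`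
  have hkey : (a₁ - a₃) • l₁ = (a₃ - a₂) • l₂ := by
    have h := ha₃ x hx
    rw [← hx12, smul_add, ha₁ l₁ hl₁, ha₂ l₂ hl₂, smul_add] at h
    rw [sub_smul, sub_smul, sub_eq_sub_iff_add_eq_add, add_comm (a₃ • l₂)]
    exact h
  have hmem : (a₁ - a₃) • l₁ ∈ L₁ ⊓ L₂ :=
    AddSubgroup.mem_inf.mpr ⟨L₁.zsmul_mem hl₁ _, hkey ▸ L₂.zsmul_mem hl₂ _⟩
  rw [h12, AddSubgroup.mem_bot] at hmem
  have hmem' : (a₃ - a₂) • l₂ = 0 := by rw [← hkey, hmem]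
  have hd₁ : (p : ℤ) ∣ a₁ - a₃ := dvd_of_zsmul_eq_zero hl₁0 hmem
  have hd₂ : (p : ℤ) ∣ a₃ - a₂ := dvd_of_zsmul_eq_zero hl₂0 hmem'
  have hd : (p : ℤ) ∣ a₂ - a₁ := by
    have h := hd₁.add hd₂
    rw [show a₁ - a₃ + (a₃ - a₂) = -(a₂ - a₁) by ring] at h
    exact dvd_neg.mp h
  refine ⟨a₁, fun P ↦ ?_⟩
  obtain ⟨u, hu, w, hw, rfl⟩ := AddSubgroup.mem_sup.mp (htop ▸ AddSubgroup.mem_top P)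
  rw [smul_add, ha₁ u hu, ha₂ w hw, smul_add]
  congr 1
  have : a₂ • w = a₁ • w + (a₂ - a₁) • w := by rw [← add_smul, add_sub_cancel]
  rw [this, zsmul_eq_zero_of_dvd hd, add_zero]

omit [Fact p.Prime] in
/-- A place of `ℚ` above the rational prime `p` (the prime `(p)` of `𝓞_ℚ = ℤ`). [folklore] -/
theorem exists_heightOneSpectrum_natCast_mem (hp : p.Prime) :
    ∃ v : HeightOneSpectrum (𝓞 ℚ), ((p : ℕ) : 𝓞 ℚ) ∈ v.asIdeal := by
  have hmax := span_natCast_rat_isMaximal hp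
  refine ⟨⟨Ideal.span {((p : ℕ) : 𝓞 ℚ)}, hmax.isPrime, ?_⟩, Ideal.mem_span_singleton_self _⟩
  rw [Ne, Ideal.span_singleton_eq_bot]
  exact_mod_cast hp.ne_zero

/-- **Under `Anom` and "no unramified rational `p`-line" the rational `p`-line is UNIQUE**: both lines
are ramified, hence both equal Serre's ordinary line (`exists_ordinaryLine_of_anom`,
`eq_of_not_lineUnramifiedAt`). [cite: SerreInventiones1972, §1.11 Prop. 11 and Cor.] -/
theorem isRationalLine_unique [W.IsElliptic] [W.IsGloballyMinimal] (hp2 : p ≠ 2) (hanom : Anom W p)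
    (hGL : ∀ Φ : AddSubgroup (geomTorsion W (p : ℤ)), IsRationalLine W p Φ → ¬ LineUnramifiedAt W p Φ)
    {Φ₁ Φ₂ : AddSubgroup (geomTorsion W (p : ℤ))} (hΦ₁ : IsRationalLine W p Φ₁)
    (hΦ₂ : IsRationalLine W p Φ₂) : Φ₁ = Φ₂ := by
  have hp : p.Prime := Fact.out
  obtain ⟨v, hv⟩ := exists_heightOneSpectrum_natCast_mem hp
  obtain ⟨𝔓, h𝔓⟩ := v.primesAbove_nonempty
  obtain ⟨L, hLcard, hLsub, -⟩ := exists_ordinaryLine_of_anom W hp2 hanom v hv 𝔓 h𝔓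
  rw [eq_of_not_lineUnramifiedAt hΦ₁ (hGL Φ₁ hΦ₁) hv h𝔓 hLcard hLsub,
    eq_of_not_lineUnramifiedAt hΦ₂ (hGL Φ₂ hΦ₂) hv h𝔓 hLcard hLsub]

end Lines

/-! ## §2 Over an imaginary quadratic `K`: a `Γ_K`-stable `p`-line is rational -/

section Quadratic

variable {W : WeierstrassCurve ℚ} [W.IsElliptic] [W.IsGloballyMinimal] {p : ℕ} [Fact p.Prime]
  {K : Type} [Field K] [NumberField K]

omit [W.IsElliptic] [W.IsGloballyMinimal] [Fact p.Prime] in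
/-- The image of a `p`-line under an element of `Γ_ℚ` is a `p`-line. [folklore] -/
theorem natCard_map_eq (c : absoluteGaloisGroup ℚ) {Ψ : AddSubgroup (geomTorsion W (p : ℤ))}
    (hΨ : Nat.card Ψ = p) :
    Nat.card (Ψ.map (DistribSMul.toAddMonoidHom (geomTorsion W (p : ℤ)) c)) = p := by
  rw [← Nat.card_congr (Ψ.equivMapOfInjective (DistribSMul.toAddMonoidHom (geomTorsion W (p : ℤ)) c)
    (MulAction.injective c)).toEquiv, hΨ]

/-- **A `Γ_K`-stable `p`-line of `E[p](ℚ̄)` is rational** (`K` imaginary quadratic, `E/ℚ` with a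
good anomalous Eisenstein prime `p > 2` and no unramified rational `p`-line): see the module docstring.
[cite: SerreInventiones1972, §1.11] [cite: GreenbergVatsal2000, p. 4] -/
theorem isRationalLine_of_forall_restrict_smul_mem (hp2 : p ≠ 2) (hanom : Anom W p)
    (hGL : ∀ Φ : AddSubgroup (geomTorsion W (p : ℤ)), IsRationalLine W p Φ → ¬ LineUnramifiedAt W p Φ)
    (hK : IsImaginaryQuadratic K) {Ψ : AddSubgroup (geomTorsion W (p : ℤ))} (hΨ : Nat.card Ψ = p)
    (hstab : ∀ (τ : absoluteGaloisGroup K), ∀ P ∈ Ψ, absGaloisRestrict ℚ K τ • P ∈ Ψ) :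
    IsRationalLine W p Ψ := by
  have hp : p.Prime := Fact.out
  -- the rational line `Φ₀` and its uniqueness
  obtain ⟨Φ₀, hΦ₀⟩ := exists_isRationalLine_of_not_irr W p hanom.1
  have huniq : ∀ Φ, IsRationalLine W p Φ → Φ = Φ₀ := fun Φ hΦ ↦
    isRationalLine_unique hp2 hanom hGL hΦ hΦ₀
  by_cases hΨ0 : Ψ = Φ₀
  · rw [hΨ0]; exact hΦ₀
  -- complex conjugation `c ∉ Γ_K`, the index-2 structure
  haveI : IsTotallyComplex K := hK.2
  obtain ⟨c, hc⟩ := exists_isComplexConjugation (Rat.castHom ℝ)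
  have hcK : c ∉ Set.range (absGaloisRestrict ℚ K) :=
    hc.not_mem_range_absGaloisRestrict (L := K) (fun w ↦ IsTotallyComplex.isComplex w)
  have hc2 : c * c = 1 := by rw [← pow_two]; exact hc.sq_eq_one
  have hcinv : c⁻¹ = c := inv_eq_of_mul_eq_one_left hc2
  have hidx : (absGaloisRestrict ℚ K).range.index = 2 := by
    rw [index_range_absGaloisRestrict_eq_finrank, hK.1]
  haveI hnormal : (absGaloisRestrict ℚ K).range.Normal := Subgroup.normal_of_index_eq_two hidx
  have hconj : ∀ τ : absoluteGaloisGroup K, ∃ τ' : absoluteGaloisGroup K,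
      absGaloisRestrict ℚ K τ' = c⁻¹ * absGaloisRestrict ℚ K τ * c := fun τ ↦ by
    obtain ⟨τ', hτ'⟩ := hnormal.conj_mem _ ⟨τ, rfl⟩ c⁻¹
    rw [inv_inv] at hτ'
    exact ⟨τ', hτ'⟩
  have hcoset : ∀ g : absoluteGaloisGroup ℚ, g ∉ Set.range (absGaloisRestrict ℚ K) →
      ∃ τ : absoluteGaloisGroup K, g = c * absGaloisRestrict ℚ K τ := fun g hg ↦ by
    obtain ⟨τ, hτ⟩ := inv_mul_mem_range_absGaloisRestrict hK.1 hcK hg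
    exact ⟨τ, by rw [hτ, mul_inv_cancel_left]⟩
  -- a line stable under `Γ_K` and under `c` is rational
  have hrat : ∀ Φ : AddSubgroup (geomTorsion W (p : ℤ)), Nat.card Φ = p →
      (∀ (τ : absoluteGaloisGroup K), ∀ P ∈ Φ, absGaloisRestrict ℚ K τ • P ∈ Φ) →
      (∀ P ∈ Φ, c • P ∈ Φ) → IsRationalLine W p Φ := by
    intro Φ hΦ hτ hcΦ
    refine ⟨hΦ, fun g P hP ↦ ?_⟩
    by_cases hg : g ∈ Set.range (absGaloisRestrict ℚ K)
    · obtain ⟨τ, rfl⟩ := hg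
      exact hτ τ P hP
    · obtain ⟨τ, rfl⟩ := hcoset g hg
      rw [mul_smul]
      exact hcΦ _ (hτ τ P hP)
  -- the conjugate line `c • Ψ` is `Γ_K`-stable
  set cΨ : AddSubgroup (geomTorsion W (p : ℤ)) :=
    Ψ.map (DistribSMul.toAddMonoidHom (geomTorsion W (p : ℤ)) c) with hcΨdef
  have hcΨcard : Nat.card cΨ = p := natCard_map_eq c hΨ
  have hmem_cΨ : ∀ {P}, P ∈ cΨ ↔ c • P ∈ Ψ := fun {P} ↦ by
    constructor
    · rintro ⟨Q, hQ, rfl⟩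
      change c • (c • Q) ∈ Ψ
      rwa [← mul_smul, hc2, one_smul]
    · intro h
      exact ⟨c • P, h, by change c • (c • P) = P; rw [← mul_smul, hc2, one_smul]⟩
  have hcΨstab : ∀ (τ : absoluteGaloisGroup K), ∀ P ∈ cΨ, absGaloisRestrict ℚ K τ • P ∈ cΨ := by
    intro τ P hP
    obtain ⟨τ', hτ'⟩ := hconj τ
    rw [hmem_cΨ] at hP ⊢
    rw [← mul_smul, show c * absGaloisRestrict ℚ K τ = absGaloisRestrict ℚ K τ' * c by
      rw [hτ', hcinv, mul_assoc (c * absGaloisRestrict ℚ K τ), hc2, mul_one], mul_smul]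
    exact hstab τ' _ hP
  by_cases hcΨ : cΨ = Ψ
  · -- `Ψ` is `c`-stable, hence rational
    refine hrat Ψ hΨ hstab fun P hP ↦ ?_
    have : P ∈ cΨ := hcΨ.symm ▸ hP
    exact hmem_cΨ.mp this
  · -- three `Γ_K`-stable lines `Φ₀, Ψ, cΨ`: `Γ_K` acts by scalars
    exfalso
    have hΦ₀c : ∀ P ∈ Φ₀, c • P ∈ Φ₀ := fun P hP ↦ hΦ₀.2 c P hP
    have hcΨ0 : cΨ ≠ Φ₀ := by
      intro h
      apply hΨ0
      ext P
      constructor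
      · intro hP
        have h1 : c • P ∈ cΨ := hmem_cΨ.mpr (by rwa [← mul_smul, hc2, one_smul])
        rw [h] at h1
        have h2 := hΦ₀c _ h1
        rwa [← mul_smul, hc2, one_smul] at h2
      · intro hP
        have h1 : c • P ∈ Φ₀ := hΦ₀c P hP
        rw [← h] at h1
        have h2 := hmem_cΨ.mp h1
        rwa [← mul_smul, hc2, one_smul] at h2
    have hscalar : ∀ τ : absoluteGaloisGroup K, ∃ a : ℤ, ∀ P : geomTorsion W (p : ℤ),
        absGaloisRestrict ℚ K τ • P = a • P := fun τ ↦
      exists_int_smul_eq_of_three_lines hΦ₀.1 hΨ hcΨcard (Ne.symm hΨ0) (Ne.symm hcΨ0)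
        (Ne.symm hcΨ) (fun P hP ↦ hΦ₀.2 _ P hP) (hstab τ) (hcΨstab τ)
    -- the `±1`-eigenvectors of `c` span rational lines, both equal to `Φ₀`
    obtain ⟨⟨P, hP0, hcP⟩, ⟨Q, hQ0, hcQ⟩⟩ :=
      exists_fixed_and_antifixed_of_isComplexConjugation W hp2 c hc
    have hline : ∀ R : geomTorsion W (p : ℤ), R ≠ 0 → (c • R = R ∨ c • R = -R) →
        AddSubgroup.zmultiples R = Φ₀ := by
      intro R hR0 hcR
      refine huniq _ (hrat _ (natCard_zmultiples_eq hR0) (fun τ S hS ↦ ?_) (fun S hS ↦ ?_))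
      · obtain ⟨m, rfl⟩ := AddSubgroup.mem_zmultiples_iff.mp hS
        obtain ⟨a, ha⟩ := hscalar τ
        rw [ha, smul_comm a m R]
        exact AddSubgroup.zsmul_mem _ (AddSubgroup.zsmul_mem _ (AddSubgroup.mem_zmultiples R) a) m
      · obtain ⟨m, rfl⟩ := AddSubgroup.mem_zmultiples_iff.mp hS
        rw [smul_comm c m R]
        rcases hcR with h | h
        · rw [h]; exact AddSubgroup.zsmul_mem _ (AddSubgroup.mem_zmultiples R) m
        · rw [h, smul_neg]
          exact AddSubgroup.neg_mem _ (AddSubgroup.zsmul_mem _ (AddSubgroup.mem_zmultiples R) m)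
    have hPΦ := hline P hP0 (Or.inl hcP)
    have hQΦ := hline Q hQ0 (Or.inr hcQ)
    have hQP : Q ∈ AddSubgroup.zmultiples P := by
      rw [hPΦ, ← hQΦ]; exact AddSubgroup.mem_zmultiples Q
    obtain ⟨k, hk⟩ := AddSubgroup.mem_zmultiples_iff.mp hQP
    have hcQ' : c • Q = Q := by rw [← hk, smul_comm c k P, hcP]
    rw [hcQ'] at hcQ
    have h2 : Q + Q = 0 := by
      nth_rewrite 2 [hcQ]
      exact add_neg_cancel Q
    exact hQ0 (eq_zero_of_add_self_eq_zero hp2 h2)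

end Quadratic

end Summit.BirchSwinnertonDyer.BirchSwinnertonDyer.Theorems.ResidualLineRigidity

end
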